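import Mathlib.Analysis.Complex.Liouville
import Mathlib.Analysis.SpecialFunctions.Complex.LogBounds
import Mathlib.Analysis.SpecialFunctions.Complex.LogDeriv
import Mathlib.Analysis.Calculus.MeanValue
import Mathlib.Topology.MetricSpace.Contracting
import Mathlib.Algebra.BigOperators.Pi
import HarnessLib

/-!
# A fixed-point lemma: solving `e^{ξⱼ} = 1 + gⱼ(ξ)` for small holomorphic `gⱼ`

The "Newton step" of D. Masser's argument for exponential points on varieties with dominant
additive projection (D'Aquino–Fornasiero–Terzo, *Generic solutions of equations with iterated
exponentials*, Trans. AMS 370 (2018), §2, Lemma 2.2 = Kantorovich's theorem, and the end of the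
proofs of Thms 2.1, 2.7: "for `t` large enough, `F` satisfies the hypothesis of Lemma 2.2 on an
open ball of center `0`"), in the contraction form that suffices there:

* `Literature.NumberTheory.Transcendental.ExpDominant.exists_exp_eq_one_add` — if `g₁, …, gₙ` are holomorphic on the unit
  polydisc of `ℂⁿ` (sup norm) with `‖gⱼ‖ ≤ ε`, `16 (n + 1) ε ≤ 1`, then there is `ξ` with
  `‖ξ‖ ≤ 1/2` and `e^{ξⱼ} = 1 + gⱼ(ξ)` for all `j`.

Proof: `Φ(ξ)ⱼ = log (1 + gⱼ(ξ))` maps the closed polydisc of radius `1/2` into itself and is a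
`1/2`-contraction there — its partial derivatives are bounded by Cauchy's estimate on coordinate
discs (Mathlib `Complex.norm_deriv_le_of_forall_mem_sphere_norm_le`) and the mean value
inequality (`Convex.lipschitzOnWith_of_nnnorm_fderiv_le`) — so Banach's fixed point theorem
(`ContractingWith.exists_fixedPoint'`) gives `ξ = Φ(ξ)`, i.e. `e^{ξⱼ} = 1 + gⱼ(ξ)`. This replaces
Kantorovich's theorem (DFT Lemma 2.2), which Mathlib lacks.

## References

* P. D'Aquino, A. Fornasiero, G. Terzo, Trans. Amer. Math. Soc. 370 (2018), §2, Lemma 2.2.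
* L. V. Kantorovich, G. P. Akilov, *Functional analysis*, XVIII (Newton–Kantorovich).
-/

noncomputable section

open Complex Metric Set Filter Topology

namespace Literature.NumberTheory.Transcendental.ExpDominant

/-- **Fixed-point form of the Newton step** (replacing Kantorovich's theorem, DFT 2018 Lemma 2.2):
if `gⱼ` (`j < n`) are holomorphic on the open unit polydisc of `ℂⁿ` with `‖gⱼ(ξ)‖ ≤ ε` and
`16 (n + 1) ε ≤ 1`, then `e^{ξⱼ} = 1 + gⱼ(ξ)` (`j < n`) has a solution with `‖ξ‖ ≤ 1/2`.
[cite: DaquinoFornasieroTerzo2017, Lemma 2.2] -/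
theorem exists_exp_eq_one_add {n : ℕ} (g : Fin n → (Fin n → ℂ) → ℂ) {ε : ℝ}
    (hε0 : 0 ≤ ε) (hε : 16 * (n + 1) * ε ≤ 1)
    (hg : ∀ j, DifferentiableOn ℂ (g j) (ball 0 1))
    (hbound : ∀ j, ∀ ξ ∈ ball (0 : Fin n → ℂ) 1, ‖g j ξ‖ ≤ ε) :
    ∃ ξ : Fin n → ℂ, ‖ξ‖ ≤ 1 / 2 ∧ ∀ j, exp (ξ j) = 1 + g j ξ := by
  classical
  have hn0 : (0 : ℝ) ≤ n := Nat.cast_nonneg n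
  have hε1 : ε ≤ 1 / 16 := by nlinarith
  have hnε : (n : ℝ) * (6 * ε) ≤ 1 / 2 := by nlinarith
  set Φ : (Fin n → ℂ) → (Fin n → ℂ) := fun ξ j => log (1 + g j ξ) with hΦ
  set K : Set (Fin n → ℂ) := closedBall 0 (1 / 2) with hK
  have hKball : K ⊆ ball 0 1 := closedBall_subset_ball (by norm_num)
  have hg_small : ∀ j, ∀ ξ ∈ ball (0 : Fin n → ℂ) 1, ‖g j ξ‖ ≤ 1 / 2 := fun j ξ hξ =>
    (hbound j ξ hξ).trans (by linarith)
  have hg_lt : ∀ j, ∀ ξ ∈ ball (0 : Fin n → ℂ) 1, ‖g j ξ‖ < 1 := fun j ξ hξ =>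
    (hg_small j ξ hξ).trans_lt (by norm_num)
  have hlog_le : ∀ j, ∀ ξ ∈ ball (0 : Fin n → ℂ) 1, ‖log (1 + g j ξ)‖ ≤ 3 / 2 * ε :=
    fun j ξ hξ =>
    (Complex.norm_log_one_add_half_le_self (hg_small j ξ hξ)).trans (by linarith [hbound j ξ hξ])
  -- `Φ` maps `K` into `K`
  have hmaps : MapsTo Φ K K := by
    intro ξ hξ
    rw [hK, mem_closedBall, dist_zero_right, pi_norm_le_iff_of_nonneg (by norm_num)]
    intro j
    exact (hlog_le j ξ (hKball hξ)).trans (by linarith)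
  -- `Φ` is differentiable on the open unit polydisc
  have hΦdiff : ∀ ξ ∈ ball (0 : Fin n → ℂ) 1, DifferentiableAt ℂ Φ ξ := by
    intro ξ hξ
    refine differentiableAt_pi.2 fun j => ?_
    have h1 : DifferentiableAt ℂ (fun ξ => 1 + g j ξ) ξ :=
      ((hg j).differentiableAt (isOpen_ball.mem_nhds hξ)).const_add 1
    exact h1.clog (mem_slitPlane_of_norm_lt_one (hg_lt j ξ hξ))
  -- the derivative of `Φ` has operator norm `≤ 1/2` on `K`
  have hderiv : ∀ ξ ∈ K, ‖fderiv ℂ Φ ξ‖ ≤ 1 / 2 := by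
    intro ξ hξ
    have hξn : ‖ξ‖ ≤ 1 / 2 := by simpa [hK, dist_zero_right] using hξ
    set L := fderiv ℂ Φ ξ with hL
    have hΦL : HasFDerivAt Φ L ξ := (hΦdiff ξ (hKball hξ)).hasFDerivAt
    set b : Fin n → (Fin n → ℂ) := fun i j => if i = j then 1 else 0 with hb
    have hbnorm : ∀ i, ‖b i‖ ≤ 1 := fun i => by
      rw [pi_norm_le_iff_of_nonneg zero_le_one]
      intro j
      by_cases h : i = j <;> simp [hb, h]
    have hline : ∀ i, ∀ z : ℂ, ‖z‖ < 1 / 2 → ξ + z • b i ∈ ball (0 : Fin n → ℂ) 1 := by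
      intro i z hz
      rw [mem_ball, dist_zero_right]
      calc ‖ξ + z • b i‖ ≤ ‖ξ‖ + ‖z • b i‖ := norm_add_le _ _
        _ ≤ 1 / 2 + ‖z‖ * 1 := by
            rw [norm_smul]
            exact add_le_add hξn (mul_le_mul_of_nonneg_left (hbnorm i) (norm_nonneg _))
        _ < 1 := by linarith
    -- Cauchy's estimate on coordinate slices
    have hLb : ∀ i j, ‖L (b i) j‖ ≤ 6 * ε := by
      intro i j
      set ψ : ℂ → ℂ := fun z => log (1 + g j (ξ + z • b i)) with hψ
      have hψderiv : HasDerivAt ψ (L (b i) j) 0 := by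
        have h1 : HasDerivAt (fun z : ℂ => ξ + z • b i) (b i) 0 := by
          simpa using ((hasDerivAt_id (0 : ℂ)).smul_const (b i)).const_add ξ
        have h2 : HasFDerivAt Φ L (ξ + (0 : ℂ) • b i) := by simpa using hΦL
        have h3 := h2.comp_hasDerivAt (0 : ℂ) h1
        have h4 := (hasDerivAt_pi.1 h3) j
        simpa [hψ, hΦ, Function.comp_def] using h4
      have hψdiff : DifferentiableOn ℂ ψ (ball 0 (1 / 2)) := by
        intro z hz
        have hz' : ‖z‖ < 1 / 2 := by simpa [dist_zero_right] using hz
        have hmem := hline i z hz'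
        have h1 : DifferentiableAt ℂ (fun z : ℂ => ξ + z • b i) z :=
          (differentiableAt_id.smul_const (b i)).const_add ξ
        have h2 : DifferentiableAt ℂ (g j) (ξ + z • b i) :=
          (hg j).differentiableAt (isOpen_ball.mem_nhds hmem)
        have h3 : DifferentiableAt ℂ (fun z : ℂ => 1 + g j (ξ + z • b i)) z :=
          (h2.comp z h1).const_add 1
        exact (h3.clog (mem_slitPlane_of_norm_lt_one (hg_lt j _ hmem))).differentiableWithinAt
      have hC : ∀ z ∈ sphere (0 : ℂ) (1 / 4), ‖ψ z‖ ≤ 3 / 2 * ε := by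
        intro z hz
        have hz' : ‖z‖ < 1 / 2 := by
          have : ‖z‖ = 1 / 4 := by simpa [dist_zero_right] using hz
          linarith
        exact hlog_le j _ (hline i z hz')
      have hdc : DiffContOnCl ℂ ψ (ball 0 (1 / 4)) := by
        refine (hψdiff.mono ?_).diffContOnCl
        rw [closure_ball _ (by norm_num)]
        exact closedBall_subset_ball (by norm_num)
      have hcauchy := Complex.norm_deriv_le_of_forall_mem_sphere_norm_le
        (by norm_num : (0 : ℝ) < 1 / 4) hdc hC
      rw [hψderiv.deriv] at hcauchy
      linarith [show 3 / 2 * ε / (1 / 4) = 6 * ε by ring]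
    refine ContinuousLinearMap.opNorm_le_bound L (by norm_num) fun h => ?_
    have hdecomp : L h = ∑ i, h i • L (b i) := by
      conv_lhs => rw [pi_eq_sum_univ h]
      simp only [map_sum, map_smul, hb]
    rw [hdecomp]
    calc ‖∑ i, h i • L (b i)‖ ≤ ∑ i, ‖h i • L (b i)‖ := norm_sum_le _ _
      _ ≤ ∑ _i : Fin n, ‖h‖ * (6 * ε) := Finset.sum_le_sum fun i _ => by
          rw [norm_smul]
          refine mul_le_mul (norm_le_pi_norm h i) ?_ (norm_nonneg _) (norm_nonneg _)
          rw [pi_norm_le_iff_of_nonneg (by positivity)]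
          exact fun j => hLb i j
      _ = n * (6 * ε) * ‖h‖ := by
          rw [Finset.sum_const, Finset.card_univ, Fintype.card_fin, nsmul_eq_mul]; ring
      _ ≤ 1 / 2 * ‖h‖ := mul_le_mul_of_nonneg_right hnε (norm_nonneg _)
  -- `Φ` is a `1/2`-contraction of the complete set `K`
  have hlip : LipschitzOnWith (1 / 2) Φ K := by
    refine (convex_closedBall _ _).lipschitzOnWith_of_nnnorm_fderiv_le
      (fun x hx => hΦdiff x (hKball hx)) fun x hx => ?_
    rw [← NNReal.coe_le_coe]
    simpa using hderiv x hx
  have hcontr : ContractingWith (1 / 2) (hmaps.restrict Φ K K) :=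
    ⟨by norm_num, hmaps.lipschitzOnWith_iff_restrict.1 hlip⟩
  have hcomplete : IsComplete K := isClosed_closedBall.isComplete
  have h0K : (0 : Fin n → ℂ) ∈ K := by simp [hK]
  obtain ⟨ξ, hξK, hfix, -⟩ :=
    ContractingWith.exists_fixedPoint' hcomplete hmaps hcontr h0K (edist_ne_top _ _)
  refine ⟨ξ, by simpa [hK, dist_zero_right] using hξK, fun j => ?_⟩
  have hj : log (1 + g j ξ) = ξ j := congr_fun hfix j
  rw [← hj]
  exact exp_log (slitPlane_ne_zero (mem_slitPlane_of_norm_lt_one (hg_lt j ξ (hKball hξK))))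

end Literature.NumberTheory.Transcendental.ExpDominant
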